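import Mathlib
import HarnessLib
import HarnessLib.Audit
import Summits.Parity.Statement
import Literature.NumberTheory.Sieve.LinearEquationsInPrimesLevelTwoInputs
import HarnessLib.Audit.Status.Attr

/-!
Route: GreenTaoLevelTwo

CLOSED (proved) 2026-08-31T18:46:23Z by operator:999:3261883 — reason: proved:Summit.Parity.GeneralizedHardyLittlewood.Theses.GreenTaoLevelTwo.mainTheoremLeFour_proof — note: success close on decomp-parity-writer-1 g26 READY line (REQUESTS l.68805 (2b) + l.68841): ALL PROVED 6/6; deciding theorem landed p830947 (commit 774f3b353208); writer probe Landing_GT2_g26.lean 866546c97016242a farm rc 0, std axioms; rung F-GT2, summit_closing false; operator priority32b. The file is kept as the record of this route; refuted decls are indexed as negative knowledge (`ledger negatives`).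

# Route GreenTaoLevelTwo — the level-2 rung of GHL — U³ inverse + quadratic Möbius + (12.6)₂ on the
explicit Heisenberg class give the Main Theorem for t ≤ 4 forms

HONESTY LABEL (ROUND-6 §0, verbatim): FORMALISATION-FIRST of PRINTED THEOREMS (B. Green, T. Tao: *An
inverse theorem for the Gowers U³(G) norm*, Proc. Edinb. Math. Soc. 51 (2008) 73–153 =
arXiv:math/0503014; *Quadratic uniformity of the Möbius function*, Ann. Inst. Fourier 58 (2008)
1863–1935 = arXiv:math/0606087; *Linear equations in primes*, Ann. of Math. 171 (2010) 1753–1850,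
§§10–12 + App. D). SUB-SUMMIT RUNG: a LITERAL RESTRICTION of the conjunct
`Summit.Parity.GeneralizedHardyLittlewood` (Conj. 1.2, all complexities) to systems of complexity ≤
2 — in particular every non-degenerate finite-complexity system of t ≤ 4 affine-linear forms. NOT
summit motion; NOT distance to twins/Goldbach (infinite complexity); no new mathematics claimed.
X = the two PRINTED XL inputs of level 2 of Green–Tao's *Linear equations in primes* programme plus
two support statements closable in days, asked only of the explicit Heisenberg class
𝒞₂(H_d) (products of the re-metrised Heisenberg nilmanifold `heisenbergWith d` and the circle), for
EVERY metric d satisfying Def. 8.1 and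
bi-Lipschitz comparable to the explicit box pre-distance ρ₀ = inf_γ S(gγh⁻¹): X = HeisMetricExists ∧
GITwo ∧ MNTwo ∧ SharpTwo, where GITwo is
the U³[N] inverse theorem with inverse families in 𝒞₂ (Green–Tao 2008a Thm. 12.8), MNTwo is Möbius ⟂
2-step nilsequences of 𝒞₂ with every
log-power saving (Green–Tao 2008b Thm. 1.1) — the two cruxes —, SharpTwo (support) is GT2010 (12.6)
at s = 2, since 2026-08-27 the s = 2 INSTANCE of the tree THEOREM
`GreenTao2010_sharpGoldstonYildirim_holds` (p547825, from the PROVED Thm. D.3), and HeisMetricExists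
(support, construction) says such a d exists (Green–Tao 2012b Def. 2.2 + App. A for H³). It suffices
to show X: the tree
PROVES the whole level-s transference machine class-locally
(`GreenTao2010_gowersUniformityAt_of_class_of_sharp`) and the level-2 chain to the
Main Theorem, assembled sorry-free in
`Literature.NumberTheory.Sieve.GreenTao2010_mainTheorem_of_le_four_of_inputs : HeisMetricExists →
GITwo →
MNTwo → SharpTwo → MainTheoremLeFour`; the rung leaf is the LITERATURE-LEVEL statement
`Literature.NumberTheory.Sieve.GreenTaoLevelTwo.MainTheoremLeFour` (LANDED p548161; to be
registered as an ALT-CLOSER rung leaf of Parity/GeneralizedHardyLittlewood, class rung / FRONTIER,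
like F-S3's `Zhang2022.Skeleton.Theorem1`) = GT2010's Main Theorem for every non-degenerate
finite-complexity system of t ≤ 4
affine-linear forms — a LITERAL RESTRICTION of the conjunct
`Summit.Parity.GeneralizedHardyLittlewood` (all complexities) to complexity ≤ 2,
containing the Hardy–Littlewood asymptotic for 4-term progressions of primes. Honesty label:
FORMALISATION-FIRST of printed theorems
(2008–2010); no new mathematics; SUB-SUMMIT rung on the FRONTIER ledger, never rendered as distance
to the summit (infinite complexity). Open content of X = GITwo ∧ MNTwo only.
Lean: `Literature.NumberTheory.Sieve.GreenTaoLevelTwo.HeisMetricExists ∧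
Literature.NumberTheory.Sieve.GreenTaoLevelTwo.GITwo ∧
Literature.NumberTheory.Sieve.GreenTaoLevelTwo.MNTwo ∧
Literature.NumberTheory.Sieve.GreenTaoLevelTwo.SharpTwo`

## Assembly
`closes (hA : Assembly) (h₀ : HeisMetricExists) (h₁ : GITwo) (h₂ : MNTwo) (h₃ : SharpTwo) :
Literature.NumberTheory.Sieve.GreenTaoLevelTwo.MainTheoremLeFour := hA h₀ h₁ h₂ h₃`
concludes the Literature-level rung leaf BY NAME and uses all five items (BC6: declared 5 / in-cone
5 / aside 0; load-bearing OPEN cruxes GITwo, MNTwo — BC1 cone 2). The Assembly item is closable AT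
ONCE by the one line
`fun h₀ h₁ h₂ h₃ => Literature.NumberTheory.Sieve.GreenTao2010_mainTheorem_of_le_four_of_inputs h₀
h₁ h₂ h₃` (LANDED p548161, sorry-free, axioms
propext/Classical.choice/Quot.sound; emulation `Assembly_holds` rc 0): obtain d from h₀;
`heisGood_with d` (rationality and divisibility do not see the
metric); `gowersUniformityAt_two_of` = `GreenTao2010_gowersUniformityAt_of_class_of_sharp (s := 2)`
on {X | InHeisClass (heisenbergWith d) X} with
h₁ d, h₂ d, h₃; then `GreenTao2010_wTrickedProduct_of_gowersUniformity_holds 2` →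
`GreenTao2010_wTricked_of_wTrickedProduct 2` →
`GreenTao2010_mainNormalForm_of_wTricked_holds 2` → `GreenTao2010_main_of_mainNormalFormAt (s :=
2)`.

CLOSES_TARGET: closes rung F-GT2 of Parity: Literature.NumberTheory.Sieve.GreenTaoLevelTwo.MainTheoremLeFour (D-0061; not the summit Statement) — the deciding theorem of this route concludes that registered leaf instead of the Statement decl `GeneralizedHardyLittlewood` (class rung: servable and labelled, never counted as concluding the summit Statement).

Rationale: WHY THIS LINE. The tree's GT2010 layer (64 files) is level-by-level: level 1
(`GreenTao2010_gowersUniformityAt_one`) gives the Main Theorem for t ≤ 3 forms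
(`GreenTao2010_mainTheorem_of_le_three`, hence Vinogradov), and at every level s the reduction of
Thm. 7.2 to GI(s) + MN(s) + (12.6)ₛ is PROVED for an
arbitrary class of rational divisible nilmanifolds (`…MetricClass`, `…SplitVonMangoldt`,
`…FlatOrthogonality`), so no Mal'cev/Lie theory is needed
when the class is explicit; the Heisenberg nilmanifold, its rationality (Lemma E.9 by hand) and Cor.
11.6 for it are in the tree
(`…HeisenbergNilmanifold`). Level 2 is therefore exactly three theorems in print —
GreenTao2008U3Inverse (U³ inverse: Bohr sets, Bogolyubov-type
arguments, Green–Ruzsa's Freiman theorem in ℤ_N, the symmetry argument, conversion to Heisenberg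
nilsequences §12), GreenTao2008QuadraticMobius
(Vaughan-type decomposition + quantitative equidistribution of bracket quadratics, major arcs with
Siegel), GreenTao2010 App. D (LANDED for all s: `GreenTao2010_sharpGoldstonYildirim_holds`, p547825)
— plus one explicit
metric (GreenTao2012Nilmanifolds Def. 2.2). Imported areas: additive combinatorics (tree:
Balog–Szemerédi–Gowers, dense model, Gowers-norm calculus;
Mathlib: Plünnecke–Ruzsa, Freiman homomorphisms; missing: Bohr sets, Bogolyubov, GAPs via Minkowski
II) and higher-order Fourier analysis
(nothing formal exists anywhere). What the line does that no Parity route does: every existing route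
is a sieve / circle-method / correlation line of
complexity ≤ 1 or a density statement; none touches `GreenTao2010_gowersUniformityAt 2`,
`inverseConjectureAt 2` or `MNAt 2`, and the inline
decomposition programme of `GreenTao2010_gowersUniformity` is dormant since 2026-08-16; the
negatives index has no statement about Gowers norms or
nilsequences. Typing trap avoided: `Nilmanifold.heisenberg` carries a choice metric
(`metrizableSpaceMetric`) over which MN(2) is unprovable
(`MetricPathology.not_forall_MNAt`), hence the quantification over box-comparable metrics.

RANKED CRUXES. #2 GITwo (crux) — THE U³[N] INVERSE THEOREM WITH HEISENBERG-CLASS INVERSE FAMILIES: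
for every metric d on H³(ℝ)/H³(ℤ) satisfying the axioms of Def. 8.1 and bi-Lipschitz comparable to
the box pre-distance ρ₀, and every 0 < δ ≤ 1, there are finitely many nilmanifolds 𝓜_i in the class
𝒞₂(heisenbergWith d) and constants M, c > 0 such that every 1-BOUNDED f : [N] → ℝ with ‖f‖_{U³[N]} ≥
δ correlates (≥ c) with some F(gⁿx), F 1-bounded and M-Lipschitz on some 𝓜_i
(`GreenTao2010_inverseDatum 2 δ 𝓜 M c` — the printed GI(2), GT2010 Conj. 8.3 / Prop. 8.4 = GT08a
Thm. 12.8; the RELATIVE version for ν-bounded f, Prop. 10.1, is PROVED in the tree from it).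
[difficulty: XL] (why it might fail: the typed datum asks the inverse family INSIDE products of
(H_d, circle) with ONE Lipschitz constant per δ for the metric d: if GT08 §12's functions F =
χ(x,y)e(z)-type are not uniformly d-Lipschitz for every box-comparable d, or skew-shift factors are
indispensable, the class/predicate is mis-cut.) [GreenTao2008U3Inverse, GreenTao2010,
arXiv:math/0505198]
#3 MNTwo (crux) — MÖBIUS IS ORTHOGONAL TO 2-STEP NILSEQUENCES OF THE HEISENBERG CLASS: for every
box-comparable Def-8.1 metric d, every X in 𝒞₂(heisenbergWith d), every m and M, and every A > 0
there is C with |Σ_{n ≤ N} μ(n) F(gⁿ x)| ≤ C N / log^A N for all N ≥ 2, all g, x in X^m × ℝ/ℤ and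
all 1-bounded M-Lipschitz F (`GreenTao2010_MNAt 2 ((X.pow m).prod circle) M`). [difficulty: XL] (why
it might fail: the constant must be UNIFORM over all M-Lipschitz F (not per F as in AIF Thm 1.1's
statement): needs a quantitative Lipschitz → vertical-Fourier/bracket-polynomial approximation on
X^m × ℝ/ℤ with polynomial losses; Siegel makes C ineffective (allowed: ∃ C).)
[GreenTao2008QuadraticMobius, GreenTao2012Mobius, GreenTao2012Nilmanifolds]
#9 SharpTwo (support) — THE SHARP ESTIMATE (12.6) AT LEVEL 2: for some admissible cutoff χ (χ = id
on [0,½], Lipschitz) and some γ > 0, ‖Λ♯_{χ,N^γ,b,W} − 1‖_{U³[N]} = o(1) uniformly in b coprime to W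
(`GreenTao2010_sharpUniformAt 2 χ (N ↦ N^γ)`). It is VERBATIM the s = 2 instance of the named fact
`GreenTao2010_sharpGoldstonYildirim`, PROVED in the tree for every s from Thm. D.3 as
`Literature.NumberTheory.Sieve.GreenTao2010_sharpGoldstonYildirim_holds` (p547825, parity-lit g16);
closes by the one-liner `GreenTao2010_sharpGoldstonYildirim_holds 2 (by norm_num)`. [difficulty:
provable-now] [GreenTao2010, GreenTaoAnnals2008]
#9 HeisMetricExists (support) — AN EXPLICIT METRIC: there is a distance d on H³(ℝ)/H³(ℤ) with the
five axioms of Def. 8.1 (metric inducing the quotient topology) that is bi-Lipschitz comparable to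
ρ₀(gΓ,hΓ) = inf_γ max(‖gγh⁻¹‖_∞, ‖(gγh⁻¹)⁻¹‖_∞) — e.g. the chain metric generated by ρ₀ (Green–Tao
2012b Def. 2.2, App. A: "d really is a metric"), separated by the test functions e(x), e(y), e(z)Σ_k
φ(y+k)e(kx). It is also the non-vacuity witness of GITwo/MNTwo and should land first. [difficulty:
M] [GreenTao2012Nilmanifolds, GreenTao2008U3Inverse]

TWO-LAYER PLAN. GITwo ⇐ (I1) additive-combinatorial toolkit in ℤ_N: regular Bohr sets,
Bogolyubov-type lemma, Green–Ruzsa Freiman theorem (coset progressions),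
proper GAPs inside Bohr sets via Minkowski's second theorem → (I2a) GT08 §§3–7: large U³ ⇒ many
additive quadruples of the derivative phases ⇒ (BSG,
tree) ⇒ linearity on a Bohr neighbourhood ⇒ symmetry argument ⇒ local correlation with a quadratic
phase on a Bohr set (GT08 Thm 2.3-type local
inverse theorem) → (I2b) §§8–10, 12: globalisation and conversion of locally quadratic phase
functions on Bohr sets into ≤ C(δ)-Lipschitz
functions on products of Heisenberg nilmanifolds and circles, [N] ↔ ℤ_N' embedding. MNTwo ⇐ (I3a)
reduction on X^m × ℝ/ℤ of a d-Lipschitz F to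
vertical characters / bracket quadratic phases e([αn]βn + …) with polynomial losses → (I3b) AIF:
Vaughan/Type I–II for Σ μ(n)e(bracket quadratic),
quantitative equidistribution (van der Corput twice), major arcs by Siegel–Walfisz. SharpTwo ⇐ (I4)
DONE: the s = 2 instance of `GreenTao2010_sharpGoldstonYildirim_holds` (one line).
Skeleton files per crux are written by the typer seats in the first 48 h (one statement file per
paper SECTION, D-0064) and registered as BC3
skeletons; splits are filed only when a prover claims the parent. BC3 skeletons at birth (HOME
r6/bc/, each `lean check` rc 0 with sorries = stubs and the composition kernel-checked): GITwo ⇐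
`stub_cyclicInverse` (XL, GT08a Thm 12.8 over the Heisenberg class, ℤ/N′ℤ form) +
`stub_cyclicToInterval` (L); MNTwo ⇐ `stub_verticalPoly` (XL, MN for vertical-character nilsequences
with polynomial Lipschitz dependence, as GT2012a Thm 1's Q^{O(1)}(1+‖F‖_Lip)) +
`stub_verticalReduction` (M); SharpTwo needs none any more (one-liner; the r6/bc/SharpTwo_birth.lean
skeleton — stub_cubeReindex + stub_d3OverPolytope, everything else proved — is kept only as a
fallback record); HeisMetricExists ⇐ `stub_chain_compat` + `stub_chain_comparable` (chain metric of
the box gauge). BC5 rungs (plan-only, first prover targets): `stub_rung_quadraticPhase :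
QuadraticPhaseRung` (quadratic phases are Heisenberg nilsequences uniformly over box-comparable
realisations) for GITwo; `stub_rung_huaQuadratic : HuaQuadraticRung` (Σ μ(n)e(αn²+βn) ≪_A N log^{−A}
N, Hua / GT08b model case) for MNTwo.

KILL CRITERIA. Nothing refutes the MECHANISM (three published theorems and a published assembly). A
refutation of GITwo or MNTwo AS TYPED can only mean the
comparability predicate `IsBoxComparable` or the class constructor list is mis-cut (class misstated
⇒ restate: e.g. add the skew-shift constructor,
or replace ρ₀ by the Mal'cev-coordinate gauge); SharpTwo cannot be refuted (it is the s = 2 instance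
of a tree theorem). The route is closed superseded if the dormant inline programme lands
`GreenTao2010_gowersUniformityAt 2` by another path,
and is pointless if the director declines to register
`Literature.NumberTheory.Sieve.GreenTaoLevelTwo.MainTheoremLeFour` as a FRONTIER rung leaf (then:
close not-a-thesis; the Literature file
keeps the statements as named facts for the GT2010 layer).

NOT DECOMPOSED YET. Everything below the three leaves: the ≈ 24 pp of additive combinatorics (I1),
the ≈ 50 pp of GT08 proper (I2), the ≈ 55 effective pp of AIF
(I3), the ≈ 2 pp of (12.6) (I4) — sized in the ROUND-6 memo at ≈ 120–160k kernel lines in total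
(calibration 900–1 200 lines/printed page on the
tree's GT2010 / Heath-Brown 2001 / MV1975 / Iwaniec / BFI layers); typer skeletons first, then glued
splits. All constants existential (4c(iv)).

CHEAPEST FALSIFIER. (1) HeisMetricExists itself (M-sized, provable now): if NO Def-8.1 metric is
box-comparable the two cruxes are vacuous — the chain-metric construction
of Green–Tao 2012b Def. 2.2 settles it and must land FIRST. (2) Lipschitz sanity (paper + 50 Lean
lines): GT08 §12's F on the Heisenberg nilmanifold are
a smooth cutoff supported inside the open fundamental cube times e(z) («all of the functions F used
in these constructions are 2π-Lipschitz»,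
arXiv:math/0503014 p. 41) — check |F(uh) − F(h)| ≤ C·boxGauge(u) for h in the unit cube. (3)
SharpTwo — DONE, a THEOREM (p547825
`GreenTao2010_sharpGoldstonYildirim_holds`, all s; normalisation lookup positive: Λ_{χ,R} =
truncDivisorSum(−χ), (φW/W)^t cancels, main term 1, D.3 error
N^{3.8+o(1)} at R = N^{1/40}). (4) BC7 pre-run (r6/bc/bc7_probe.lean, summit := MainTheoremLeFour):
GITwo / MNTwo CLEAN (supports SharpTwo /
HeisMetricExists CLEAN as drafted; SharpTwo is now in-tree by design: support, cited by name). No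
kit job (work-bound line).

NUMBERS. Printed pages: GT08 PEMS 81 (≈ 50 needed), AIF 73 (≈ 55 effective), Green–Ruzsa 13,
Minkowski II ≈ 6, GT2010 (12.6) ≈ 2, GT2012b Def 2.2/App. A
≈ 4. Kernel-line estimate 120–160k (central 140k) = I1 22–29k + I2 45–60k + I3 50–65k + I4 LANDED
(925 lines, p547825, outside this estimate now) + I5 2–5k. Tree today: GT2010 layer 64 files /
39 721 lines; additive-combinatorics layer 114 files / 49 312 lines. Compute: 0 core-h.

DEFINITION REQUESTS. None beyond the route's own Literature statement file
`LinearEquationsInPrimesLevelTwoInputs.lean` (InHeisClass, boxGauge, heisPreDist,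
IsCompatMetric, IsBoxComparable, heisenbergWith; LANDED p548161, commit 8357d3b4e7bf). Bohr sets /
Bogolyubov / GAP notions arrive with the
I1 typer files (Literature/Combinatorics/Additive), not as route items.

Novelty: HONESTY LABEL: formalisation-first of Green–Tao 2008a (PEMS 51), 2008b (AIF 58) and 2010 (Ann. Math.
171) §12/App. D; no new mathematics;
SUB-SUMMIT rung = GHL restricted to complexity ≤ 2; FRONTIER ledger; never distance to the summit.
Searches (2026-08-27, both corpora): corpus fts «inverse theorem Gowers U3 norm Green Tao» (12 docs,
all print: [corpus:paper:arxiv-math_0503014],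
[corpus:paper:arxiv-1009.3998], [corpus:paper:arxiv-1811.00718], [corpus:paper:arxiv-2409.07962],
[corpus:paper:galaxy-pdf-469515681220236300] Tao HOFA);
corpus fts «quadratic uniformity Möbius nilsequences» ([corpus:paper:arxiv-math_0606087],
[corpus:paper:arxiv-0807.1736], [corpus:paper:arxiv-2212.09635],
[corpus:paper:arxiv-2312.10772]); `lit galaxy search "Gowers U3|inverse theorem for the
Gowers|quadratic uniformity of the M|orthogonal to nilsequences"
--star all` (30 rows, print/theses only: [galaxy:panama:341166432190535] Tao–Vu,
[galaxy:panama:324321570455569] Zhao, [galaxy:pdf:-469515681220236300]);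
`--star github` needles «gowers norm|U3 inverse|nilsequence|Bohr set|Bogolyubov» → no formalisation
repository; `lean search` GreenTao2010_* (level-2
consumers exist, producers absent); Mathlib: no Bohr sets / Bogolyubov / U³. Nearest prior art
found: the printed proofs themselves
(GreenTao2008U3Inverse Thm 12.8; GreenTao2008QuadraticMobius Thm 1.1; GreenTao2010 §12, App. D) and
the tree's own class-local reduction
`GreenTao2010_gowersUniformityAt_of_class_of_sharp` (consumer side). Delta: none  [refs: paper:arxiv-math_0503014, paper:arxiv-1009.3998, paper:arxiv-1811.00718, paper:arxiv-2409.07962, paper:galaxy-pdf-469515681220236300, paper:arxiv-math_0606087, paper:arxiv-0807.1736, paper:arxiv-2212.09635, paper:arxiv-2312.10772, GreenTao2010]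

Barriers (technique_class: transference, higher-order-fourier, nilsequences): - technique_class: transference, higher-order-fourier, nilsequences
- Literature.Barriers.Parity.TrueComplexityBinary: outside — every system in the rung has FINITE
complexity (≤ 2); the barrier concerns binary / infinite-complexity patterns that no U^{s+1} norm
controls; nothing here is claimed for them.
- Literature.Barriers.Parity.CircleMethodBinaryBarrier: outside — no binary problem; the t ≤ 4
systems of finite complexity are exactly those where generalised von Neumann + inverse theorems
replace the circle method's minor arcs.
- Literature.Barriers.Parity.PrimePairParity: outside — no prime pairs / bounded-gap pattern
(complexity ∞) is asserted; 4-APs and other complexity-2 systems are parity-insensitive in the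
Green–Tao sense (Möbius orthogonality MN(2) is a theorem).
- Literature.Barriers.Parity.SelbergParityBarrier: outside — the lower bound for primes comes from
the W-tricked transference principle with the Möbius–nilsequence theorem as the parity-breaking
input, not from a sieve; sieves enter only the enveloping majorant ν (upper bounds).
- Literature.Barriers.Parity.SiegelZeroTwinPrimes: discharged as in print — MN(2)'s constant is
INEFFECTIVE (Siegel's theorem inside the major-arc / Type I analysis of AIF); the typed
`GreenTao2010_MNAt` is ∃ C, so no effective claim collides with a possible exceptional zero.
- Literature.Barriers.Parity.BrunTitchmarshSiegelZero: outside — no sieve constant below the sieve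
limit is claimed; ν is the standard GY/Selberg majorant wit

History (route lifecycle, newest last):
- 2026-08-27T17:59:41Z · closes_target -> closes rung F-GT2 of Parity: Literature.NumberTheory.Sieve.GreenTaoLevelTwo.MainTheoremLeFour (D-0061; not the summit Statement) (planner-parity-ideate-p2-g11-0)
- 2026-08-31T18:46:23Z · CLOSED proved — proved:Summit.Parity.GeneralizedHardyLittlewood.Theses.GreenTaoLevelTwo.mainTheoremLeFour_proof (operator:999:3261883)

sub-problem: GeneralizedHardyLittlewood · status: closed(proved) · opened planner-parity-ideate-p2-g11-0 2026-08-27T17:42:33Z · rev 3 · ledger route-Parity-GreenTaoLevelTwo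
GENERATED by the gate from the ledger (D-0016/17). Provers cite these decls: `theorem foo : Summit.Parity.GeneralizedHardyLittlewood.Theses.GreenTaoLevelTwo.<Decl> := …` in Summits/Parity/GeneralizedHardyLittlewood/Theorems/<Name>.lean.
-/

namespace Summit.Parity.GeneralizedHardyLittlewood.Theses.GreenTaoLevelTwo

open scoped BigOperators Topology Manifold Classical MeasureTheory ProbabilityTheory Matrix InnerProductSpace ComplexConjugate ContinuousMap
open Filter Set Function TopologicalSpace MeasureTheory

attribute [summit_statement] _root_.GeneralizedHardyLittlewood
attribute [summit_statement] _root_.Literature.NumberTheory.Sieve.GreenTaoLevelTwo.MainTheoremLeFour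

/-- item stmt-Parity-21275 · crux · rank 2 · closed · proved by Summit.Parity.GeneralizedHardyLittlewood.Theses.GreenTaoLevelTwo.GITwo_proof (prover) · by planner
why it might fail: the typed datum asks the inverse family INSIDE products of (H_d, circle) with ONE Lipschitz constant per δ for the metric d: if GT08 §12's functions F = χ(x,y)e(z)-type are not uniformly d-Lipschitz for every box-comparable d, or skew-shift factors are indispensable, the class/predicate is mis-cut.
sources: GreenTao2008U3Inverse, GreenTao2010, arXiv:math/0505198
[crux] THE U³[N] INVERSE THEOREM WITH HEISENBERG-CLASS INVERSE FAMILIES: for every metric d on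
H³(ℝ)/H³(ℤ) satisfying the axioms of Def. 8.1 and bi-Lipschitz comparable to the box pre-distance
ρ₀, and every 0 < δ ≤ 1, there are finitely many nilmanifolds 𝓜_i in the class 𝒞₂(heisenbergWith d)
and constants M, c > 0 such that every 1-BOUNDED f : [N] → ℝ with ‖f‖_{U³[N]} ≥ δ correlates (≥ c)
with some F(gⁿx), F 1-bounded and M-Lipschitz on some 𝓜_i (`GreenTao2010_inverseDatum 2 δ 𝓜 M c` —
the printed GI(2), GT2010 Conj. 8.3 / Prop. 8.4 = GT08a Thm. 12.8; the RELATIVE version for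
ν-bounded f, Prop. 10.1, is PROVED in the tree from it). [difficulty: XL] -/
@[route_item "route-Parity-GreenTaoLevelTwo", crux]
def GITwo : Prop :=
  Literature.NumberTheory.Sieve.GreenTaoLevelTwo.GITwo

-- `GITwo` holds: proved by `Summit.Parity.GeneralizedHardyLittlewood.Theses.GreenTaoLevelTwo.GITwo_proof` (its module imports this route file, so no `_holds` link can be stated here).

/-- item stmt-Parity-21276 · crux · rank 3 · closed · proved by Summit.Parity.GeneralizedHardyLittlewood.Theses.GreenTaoLevelTwo.MNTwo_proof (prover) · by planner
why it might fail: Uniformity in F IS printed (AIF 2008 Main Thm: <<_{A,G/Gamma} ||F||_Lip log^-A N, uniform in g, x [arXiv:math/0606087 p.5]); residual risk = typing: our class ranges over EVERY box-comparable metric d and all X^m x R/Z, so C may depend on (d,m,M) only; Siegel => C ineffective (exists C allowed).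
sources: GreenTao2008QuadraticMobius, GreenTao2012Mobius, GreenTao2012Nilmanifolds, arXiv:math/0606087
[crux] MÖBIUS IS ORTHOGONAL TO 2-STEP NILSEQUENCES OF THE HEISENBERG CLASS: for every box-comparable
Def-8.1 metric d, every X in 𝒞₂(heisenbergWith d), every m and M, and every A > 0 there is C with
|Σ_{n ≤ N} μ(n) F(gⁿ x)| ≤ C N / log^A N for all N ≥ 2, all g, x in X^m × ℝ/ℤ and all 1-bounded
M-Lipschitz F (`GreenTao2010_MNAt 2 ((X.pow m).prod circle) M`). [difficulty: XL] -/
@[route_item "route-Parity-GreenTaoLevelTwo", crux]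
def MNTwo : Prop :=
  Literature.NumberTheory.Sieve.GreenTaoLevelTwo.MNTwo

-- `MNTwo` holds: proved by `Summit.Parity.GeneralizedHardyLittlewood.Theses.GreenTaoLevelTwo.MNTwo_proof` (its module imports this route file, so no `_holds` link can be stated here).

/-- item stmt-Parity-21277 · support · rank 9 · closed · proved by Summit.Parity.GeneralizedHardyLittlewood.Theorems.greenTaoLevelTwo_sharpTwo_proof (prover) · by planner
sources: GreenTao2010, GreenTaoAnnals2008
[support] THE SHARP ESTIMATE (12.6) AT LEVEL 2: for some admissible cutoff χ (χ = id on [0,½],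
Lipschitz) and some γ > 0, ‖Λ♯_{χ,N^γ,b,W} − 1‖_{U³[N]} = o(1) uniformly in b coprime to W
(`GreenTao2010_sharpUniformAt 2 χ (N ↦ N^γ)`). It is VERBATIM the s = 2 instance of the named fact
`GreenTao2010_sharpGoldstonYildirim`, PROVED in the tree for every s from Thm. D.3 as
`Literature.NumberTheory.Sieve.GreenTao2010_sharpGoldstonYildirim_holds` (p547825, parity-lit g16);
closes by the one-liner `GreenTao2010_sharpGoldstonYildirim_holds 2 (by norm_num)`. [difficulty:
provable-now] -/
@[route_item "route-Parity-GreenTaoLevelTwo", crux]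
def SharpTwo : Prop :=
  Literature.NumberTheory.Sieve.GreenTaoLevelTwo.SharpTwo

-- `SharpTwo` holds: proved by `Summit.Parity.GeneralizedHardyLittlewood.Theorems.greenTaoLevelTwo_sharpTwo_proof` (its module imports this route file, so no `_holds` link can be stated here).

/-- item stmt-Parity-21278 · support · rank 9 · closed · proved by Summit.Parity.GeneralizedHardyLittlewood.Theorems.greenTaoLevelTwo_heisMetricExists_proof (prover) · by planner
sources: GreenTao2012Nilmanifolds, GreenTao2008U3Inverse
[support] AN EXPLICIT METRIC: there is a distance d on H³(ℝ)/H³(ℤ) with the five axioms of Def. 8.1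
(metric inducing the quotient topology) that is bi-Lipschitz comparable to ρ₀(gΓ,hΓ) = inf_γ
max(‖gγh⁻¹‖_∞, ‖(gγh⁻¹)⁻¹‖_∞) — e.g. the chain metric generated by ρ₀ (Green–Tao 2012b Def. 2.2,
App. A: "d really is a metric"), separated by the test functions e(x), e(y), e(z)Σ_k φ(y+k)e(kx). It
is also the non-vacuity witness of GITwo/MNTwo and should land first. [difficulty: M] -/
@[route_item "route-Parity-GreenTaoLevelTwo", crux]
def HeisMetricExists : Prop :=
  Literature.NumberTheory.Sieve.GreenTaoLevelTwo.HeisMetricExists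

-- `HeisMetricExists` holds: proved by `Summit.Parity.GeneralizedHardyLittlewood.Theorems.greenTaoLevelTwo_heisMetricExists_proof` (its module imports this route file, so no `_holds` link can be stated here).

/-- item stmt-Parity-21367 · support · rank 9 · closed · proved by Summit.Parity.GeneralizedHardyLittlewood.Theorems.huaQuadraticRung_proof (prover) · by planner
sources: GreenTao2008QuadraticMobius, GreenTao2012Mobius, arXiv:math/0606087, IwaniecKowalski2004
[support] HUA'S ESTIMATE — the first rung of MNTwo (rank 3): for every A > 0 there is C
(ineffective: Siegel) with |∑_{n ≤ N} μ(n) e(αn² + βn)| ≤ C N / log^A N for all N ≥ 2, uniformly in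
α, β ∈ ℝ (Hua; the model case of Green–Tao, Quadratic uniformity of the Möbius function, AIF 58
(2008) Thm 1.1 = arXiv:math/0606087, and of the registered stub `stub_mnVertical`
(`MNAtVerticalPoly`, vertical-character nilsequences) with M = O(1); a special case of Green–Tao
2012 «Möbius ⟂ nilsequences» Thm 1.1). VERBATIM the registered BC5 stub `stub_rung_huaQuadratic` of
the MNTwo birth skeleton (stmt-Parity-21276). Technique: Vaughan's identity for μ; Type I/II sums
for quadratic phases by Weyl differencing on minor arcs; major arcs by the tree's PROVED
Siegel–Walfisz for μ (`Literature.NumberTheory.LFunctions.SiegelWalfiszMoebius_holds`) + partial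
summation; Möbius–BV (`sum_abs_moebiusAPSum_le`) available. HONESTY: a classical THEOREM,
formalisation-first, FRONTIER (feeds rung F-GT2 via MNTwo); no summit motion. Size 3–5k lines, 1
seat. [difficulty: M] -/
@[route_item "route-Parity-GreenTaoLevelTwo"]
def HuaQuadraticRung : Prop :=
  ∀ A : ℝ, 0 < A → ∃ C : ℝ, ∀ N : ℕ, 2 ≤ N → ∀ α β : ℝ, ‖∑ n ∈ Finset.Icc 1 N, ((ArithmeticFunction.moebius n : ℝ) : ℂ) * Complex.exp (2 * Real.pi * Complex.I * ((α * (n : ℝ) ^ 2 + β * n : ℝ) : ℂ))‖ ≤ C * N / Real.log N ^ A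

-- `HuaQuadraticRung` holds: proved by `Summit.Parity.GeneralizedHardyLittlewood.Theorems.huaQuadraticRung_proof` (its module imports this route file, so no `_holds` link can be stated here).

/-- item stmt-Parity-21279 · assembly · rank 1 · closed · proved by Summit.Parity.GeneralizedHardyLittlewood.Theorems.greenTaoLevelTwo_assembly_proof (prover) · by planner
sources: GreenTao2010, GreenTao2008U3Inverse, GreenTao2008QuadraticMobius
[assembly] HeisMetricExists → GITwo → MNTwo → SharpTwo → MainTheoremLeFour, the GT2010 Main Theorem
for all finite-complexity systems of t ≤ 4 forms (the level-2 assembly just described; provable now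
by one line from the LANDED Literature theorem `GreenTao2010_mainTheorem_of_le_four_of_inputs`). -/
@[route_item "route-Parity-GreenTaoLevelTwo", crux]
def Assembly : Prop :=
  HeisMetricExists → GITwo → MNTwo → SharpTwo → Literature.NumberTheory.Sieve.GreenTaoLevelTwo.MainTheoremLeFour

-- `Assembly` holds: proved by `Summit.Parity.GeneralizedHardyLittlewood.Theorems.greenTaoLevelTwo_assembly_proof` (its module imports this route file, so no `_holds` link can be stated here).

/-! D-0027 §2.1 — DECIDING THEOREM (planner-authored via `route open/edit --closes-file`; by planner-parity-ideate-p2-g11-0 2026-08-27T17:59:41Z) — ARCHIVED: route closed (proved) 2026-08-31T18:46:23Z; kept so importers keep building: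
its hypotheses are this route's items and its conclusion the registered leaf `Literature.NumberTheory.Sieve.GreenTaoLevelTwo.MainTheoremLeFour` (rung F-GT2, D-0061) (glue_lint), and it elaborates with this file. -/

@[closes "route-Parity-GreenTaoLevelTwo"] theorem closes (hA : Assembly) (h₀ : HeisMetricExists) (h₁ : GITwo) (h₂ : MNTwo) (h₃ : SharpTwo) :
    Literature.NumberTheory.Sieve.GreenTaoLevelTwo.MainTheoremLeFour :=
  hA h₀ h₁ h₂ h₃

end Summit.Parity.GeneralizedHardyLittlewood.Theses.GreenTaoLevelTwo
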